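import Literature.AlgebraicGeometry.HodgeTheory.ComplexTorusIntegralHodgeClassesProductPushforward
import HarnessLib

/-!
# Functoriality of correspondences on integral Hodge classes of complex tori: `(β ∘ α)_* = β_* ∘ α_*`

Fulton's Prop. 16.1.2 (a) for correspondences acting on the integral Hodge classes `Hdg•(−, ℤ)` of complex tori: for
`α ∈ Hdgᵃ(X × Y, ℤ)`, `β ∈ Hdgᵇ(Y × Z, ℤ)` and `x ∈ Hdgᵖ(X, ℤ)`, with the action `α_*(x) = p_{Y*}(α · p_X^* x)` (Fulton Def. 16.1.2,
Birkenhake–Lange §6.2.2) and the composite `β ∘ α = p₁₃*(p₁₂^*α · p₂₃^*β)` (Fulton Def. 16.1.1, in g27-#5's convention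
`X × (Y × Z)`), the push-forwards being those of g27-#2 (`integralHodgeClassesPushforward`, any relative dimension):

* **`integralHodgeClassesCorrComp_act`** — `(β ∘ α)_*(x) = β_*(α_*(x))`;
* `integralHodgeClassesCorrComp_act_eq`, `integralHodgeClassesCorr_act_act_eq` — both sides equal `π₃*(p₁₂^*α · p₂₃^*β · π₁^* x)`
  (Fulton's proof, p0296 L1–L6: projection formula, functoriality, and the flat base change `p_Y^* p_{Y*} = p₂₃* p₁₂^*`);
* **`integralHodgeClassesPushforward_prodMap_id_pullbackHom_fstHom'`**, **`…_id_prodMap_pullbackHom_sndHom'`** — the flat base change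
  `(f × 1_Z)_*(pr_X^* x) = pr_Y^*(f_* x)` of g27-#7 in ARBITRARY lattice frames of the products (g27-#7 states it in the concatenated frames);
* `integralHodgeClassesPushforward_eq_of_enum'` (frame change across `Fin n`, `Fin m`, `n = m`),
  `integralHodgeClassesPushforward_comp_pullbackHom_of_isIso` (`(φ ≫ f)_* φ^* = f_*` for an isomorphism `φ`),
  `prodAssocHom_comp_sndHom`, `prodAssocHom_comp_liftHom_fst_sndfst` (the associator versus `p₂₃`, `p₁₂`).

Everything is proved; no named fact is introduced (D-0026).

## References

* [Fulton1998] W. Fulton, *Intersection Theory*, 2nd ed., Springer (1998), §1.7 Prop. 1.7 (p0030), Example 1.7.4 (p0031), §16.1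
  Def. 16.1.1, Def. 16.1.2, Prop. 16.1.2 (a) (p0294 L21–L28, p0295 L9–L27, p0296 L1–L7).
* [Lange2023AbelianVarietiesComplex] H. Lange, *Abelian Varieties over the Complex Numbers*, Springer (2023), §1.1.2 (p0021 L5),
  §2.5.3 Cor. 2.5.17, §6.2.2 (p0303 L19–L29), §6.2.4 (6.10) (p0310).
* [Bredon1993] G. Bredon, *Topology and Geometry*, GTM 139, Springer (1993), Ch. VI §14 Prop. 14.1 (p0402).
* [HatcherAT2002] A. Hatcher, *Algebraic Topology*, CUP (2002), §3.3 Thm. 3.30 (p0310).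
-/

noncomputable section

open CategoryTheory Function

namespace Literature.AlgebraicGeometry.HodgeTheory

open Literature.AlgebraicGeometry.Motives Literature.AlgebraicGeometry.Motives.HodgeStructure
open Literature.Geometry.Kaehler Literature.Geometry.Kaehler.ComplexTorus

namespace ComplexTorusCat

/-! ## §0 Morphism identities for the associator; frame changes across equal sizes -/

section Morphisms

variable (X Y Z : ComplexTorusCat)

/-- `assoc ≫ p₂₃ = pr₂^{XY} × 1_Z : (X × Y) × Z → Y × Z`. [cite: Lange2023AbelianVarietiesComplex, §1.1.2 (p0021 L5)] -/
theorem prodAssocHom_comp_sndHom : prodAssocHom X Y Z ≫ sndHom X (prodObj Y Z) = prodMap (sndHom X Y) (𝟙 Z) := by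
  refine prod_hom_ext ?_ ?_
  · rw [Category.assoc, prodAssocHom_sndHom_fstHom, prodMap_fstHom]
  · rw [Category.assoc, prodAssocHom_sndHom_sndHom, prodMap_sndHom, Category.comp_id]

/-- `assoc ≫ p₁₂ = pr₁ : (X × Y) × Z → X × Y` (`p₁₂ = (pr₁, pr₁ pr₂)` on `X × (Y × Z)`). [cite: Lange2023AbelianVarietiesComplex, §1.1.2 (p0021 L5)] -/
theorem prodAssocHom_comp_liftHom_fst_sndfst :
    prodAssocHom X Y Z ≫ liftHom (fstHom X (prodObj Y Z)) (sndHom X (prodObj Y Z) ≫ fstHom Y Z) = fstHom (prodObj X Y) Z := by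
  rw [comp_liftHom, prodAssocHom_fstHom, prodAssocHom_sndHom_fstHom, ← comp_liftHom, liftHom_fstHom_sndHom, Category.comp_id]

end Morphisms

section Frames

variable {X Y : ComplexTorusCat} (p p' : ℕ) (f : X ⟶ Y) {n m n' m' l g g' : ℕ} (hn : n = m) (hn' : n' = m') (eX : Fin n ≃ X.toIsog.ι) (eX' : Fin m ≃ X.toIsog.ι)
  (eY : Fin n' ≃ Y.toIsog.ι) (eY' : Fin m' ≃ Y.toIsog.ι) (hX : l + 2 * p = n) (hg : g + g = n) (hY : l + 2 * p' = n') (hg' : g' + g' = n')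
  (hX' : l + 2 * p = m) (hgm : g + g = m) (hY' : l + 2 * p' = m') (hg'm : g' + g' = m')

include hn hn' in
/-- **`f_*` does not depend on the lattice frames**, also across frames indexed by `Fin n`, `Fin m` with `n = m` (g27-#3
`integralHodgeClassesPushforward_eq_of_enum` after `subst`). [cite: Lange2023AbelianVarietiesComplex, §2.5.3 Cor. 2.5.17 (a)] [cite: HatcherAT2002, §3.3 Thm. 3.30 (p0310 L20)] -/
theorem integralHodgeClassesPushforward_eq_of_enum' :
    integralHodgeClassesPushforward p p' f eX eY hX hg hY hg' = integralHodgeClassesPushforward p p' f eX' eY' hX' hgm hY' hg'm := by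
  subst hn hn'
  exact integralHodgeClassesPushforward_eq_of_enum p p' f eX eX' eY eY' hX hg hY hg'

end Frames

section IsoComp

variable {X X' Y : ComplexTorusCat} {n n' g g' : ℕ} (φ : X' ⟶ X) [IsIso φ] (f : X ⟶ Y) (eX' : Fin n ≃ X'.toIsog.ι) (eX : Fin n ≃ X.toIsog.ι)
  (eY : Fin n' ≃ Y.toIsog.ι) {p p' l : ℕ} (hl : l + 2 * p = n) (hg : g + g = n) (hY : l + 2 * p' = n') (hg' : g' + g' = n')

/-- **`(φ ≫ f)_*(φ^* γ) = f_* γ` for an isomorphism `φ`** (`(φ ≫ f)_* = f_* φ_*` and `φ_* φ^* = 1`, g27-#3).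
[cite: Fulton1998, Example 1.7.4 (p0031 L17–L21)] [cite: Bredon1993, Ch. VI §14 Prop. 14.1 (6) (p0402 L13)] -/
theorem integralHodgeClassesPushforward_comp_pullbackHom_of_isIso (γ : integralHodgeClasses X.toIsog.Φ p) :
    integralHodgeClassesPushforward p p' (φ ≫ f) eX' eY hl hg hY hg' (integralHodgeClassesPullbackHom φ p γ) =
      integralHodgeClassesPushforward p p' f eX eY hl hg hY hg' γ := by
  rw [integralHodgeClassesPushforward_comp p p φ eX' eX hl hg hl hg p' f eY hY hg', integralHodgeClassesPushforward_pullbackHom_of_isIso]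

end IsoComp

/-! ## §1 Flat base change along projections, arbitrary frames -/

section BaseChange

variable {X Y : ComplexTorusCat} (f : X ⟶ Y) (Z : ComplexTorusCat) {nX nY nZ N N' lX p p' gX gY G G' : ℕ} (eX : Fin nX ≃ X.toIsog.ι) (eY : Fin nY ≃ Y.toIsog.ι)
  (hX : lX + 2 * p = nX) (hgX : gX + gX = nX) (hY : lX + 2 * p' = nY) (hgY : gY + gY = nY)

/-- **`(f × 1_Z)_*(pr_X^* x) = pr_Y^*(f_* x)`** in any lattice frames `e`, `e'` of `X × Z`, `Y × Z` (g27-#7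
`integralHodgeClassesPushforward_prodMap_id_pullbackHom_fstHom` in the concatenated frames + frame independence).
[cite: Fulton1998, §1.7 Prop. 1.7 (p0030) and §1.10 Example 1.10.1 (p0035)] [cite: Lange2023AbelianVarietiesComplex, §6.2.4 (6.10) (p0310 L33–L35)] -/
theorem integralHodgeClassesPushforward_prodMap_id_pullbackHom_fstHom' (eZ : Fin nZ ≃ Z.toIsog.ι) (e : Fin N ≃ (prodObj X Z).toIsog.ι) (e' : Fin N' ≃ (prodObj Y Z).toIsog.ι)
    (hN : nX + nZ = N) (hN' : nY + nZ = N') (hXZ : (lX + nZ) + 2 * p = N) (hG : G + G = N) (hYZ : (lX + nZ) + 2 * p' = N') (hG' : G' + G' = N')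
    (x : integralHodgeClasses X.toIsog.Φ p) :
    integralHodgeClassesPushforward p p' (prodMap f (𝟙 Z)) e e' hXZ hG hYZ hG' (integralHodgeClassesPullbackHom (fstHom X Z) p x) =
      integralHodgeClassesPullbackHom (fstHom Y Z) p' (integralHodgeClassesPushforward p p' f eX eY hX hgX hY hgY x) := by
  subst hN hN'
  rw [integralHodgeClassesPushforward_eq_of_enum p p' (prodMap f (𝟙 Z)) e (sumEnum eX eZ) e' (sumEnum eY eZ) hXZ hG hYZ hG']
  exact integralHodgeClassesPushforward_prodMap_id_pullbackHom_fstHom Z f eX eY eZ hX hgX hY hgY hXZ hG hYZ hG' x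

/-- **`(1_Z × f)_*(pr_X^* x) = pr_Y^*(f_* x)`** in any lattice frames of `Z × X`, `Z × Y`.
[cite: Fulton1998, §1.7 Prop. 1.7 (p0030) and §1.10 Example 1.10.1 (p0035)] [cite: Lange2023AbelianVarietiesComplex, §6.2.4 (6.10) (p0310 L33–L35)] -/
theorem integralHodgeClassesPushforward_id_prodMap_pullbackHom_sndHom' (eZ : Fin nZ ≃ Z.toIsog.ι) (e : Fin N ≃ (prodObj Z X).toIsog.ι) (e' : Fin N' ≃ (prodObj Z Y).toIsog.ι)
    (hN : nZ + nX = N) (hN' : nZ + nY = N') (hZX : (nZ + lX) + 2 * p = N) (hG : G + G = N) (hZY : (nZ + lX) + 2 * p' = N') (hG' : G' + G' = N')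
    (x : integralHodgeClasses X.toIsog.Φ p) :
    integralHodgeClassesPushforward p p' (prodMap (𝟙 Z) f) e e' hZX hG hZY hG' (integralHodgeClassesPullbackHom (sndHom Z X) p x) =
      integralHodgeClassesPullbackHom (sndHom Z Y) p' (integralHodgeClassesPushforward p p' f eX eY hX hgX hY hgY x) := by
  subst hN hN'
  rw [integralHodgeClassesPushforward_eq_of_enum p p' (prodMap (𝟙 Z) f) e (sumEnum eZ eX) e' (sumEnum eZ eY) hZX hG hZY hG']
  exact integralHodgeClassesPushforward_id_prodMap_pullbackHom_sndHom Z f eX eY eZ hX hgX hY hgY hZX hG hZY hG' x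

end BaseChange

/-! ## §2 `(β ∘ α)_* = β_* ∘ α_*` (Fulton Prop. 16.1.2 (a)) -/

section Functoriality

variable {X Y Z : ComplexTorusCat} {gY gZ gXY gYZ gXZ gT : ℕ} (hgg₂ : gY + gZ = gYZ) (hggT : gXY + gZ = gT)
  (eY : Fin (2 * gY) ≃ Y.toIsog.ι) (eZ : Fin (2 * gZ) ≃ Z.toIsog.ι) (eXY : Fin (2 * gXY) ≃ (prodObj X Y).toIsog.ι)
  (eYZ : Fin (2 * gYZ) ≃ (prodObj Y Z).toIsog.ι) (eXZ : Fin (2 * gXZ) ≃ (prodObj X Z).toIsog.ι) (eT : Fin (2 * gT) ≃ (prodObj X (prodObj Y Z)).toIsog.ι)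
  (hgY : gY + gY = 2 * gY) (hgZ : gZ + gZ = 2 * gZ) (hgXY : gXY + gXY = 2 * gXY) (hgYZ : gYZ + gYZ = 2 * gYZ) (hgXZ : gXZ + gXZ = 2 * gXZ)
  (hgT : gT + gT = 2 * gT)
  {p a b c d ab m q₁ q₂ q₃ q₄ l₁ l₂ l₃ l₄ : ℕ} (hq₁ : a + p = q₁) (hq₂ : b + c = q₂) (hab : a + b = ab) (hq₃ : m + p = q₃) (hq₄ : ab + p = q₄)
  (h1 : l₁ + 2 * q₁ = 2 * gXY) (h1' : l₁ + 2 * c = 2 * gY) (h2 : l₂ + 2 * q₂ = 2 * gYZ) (h2' : l₂ + 2 * d = 2 * gZ)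
  (h3 : l₃ + 2 * ab = 2 * gT) (h3' : l₃ + 2 * m = 2 * gXZ) (h4 : l₄ + 2 * q₃ = 2 * gXZ) (h4' : l₄ + 2 * d = 2 * gZ)
  (h5 : l₄ + 2 * q₄ = 2 * gT) (h5' : l₂ + 2 * q₄ = 2 * gT)

/-- **`(β ∘ α)_*(x) = π₃*(p₁₂^*α · p₂₃^*β · π₁^* x)`** on `X × Y × Z` (`π₁ = p₁`, `π₃ = p₂ p₂` the projections to `X` and `Z`): the first half of Fulton's
computation — projection formula for `p₁₃` (`p₁₃*(u) · p_X^* x = p₁₃*(u · p₁₃^* p_X^* x)`), `p₁₃ ≫ p_X = π₁`, `p₁₃ ≫ p_Z = π₃` and functoriality of `_*`.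
[cite: Fulton1998, §16.1 Def. 16.1.1, Def. 16.1.2, Prop. 16.1.2 (a) (p0294 L21–L28, p0295 L9–L27, p0296 L1–L7)] [cite: Lange2023AbelianVarietiesComplex, §6.2.2 (p0303 L19–L29)] -/
theorem integralHodgeClassesCorrComp_act_eq (α : integralHodgeClasses (prodObj X Y).toIsog.Φ a) (β : integralHodgeClasses (prodObj Y Z).toIsog.Φ b)
    (x : integralHodgeClasses X.toIsog.Φ p) :
    integralHodgeClassesPushforward q₃ d (sndHom X Z) eXZ eZ h4 hgXZ h4' hgZ
        (integralHodgeClassesCup (prodObj X Z).toIsog.Φ hq₃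
          (integralHodgeClassesPushforward ab m (liftHom (fstHom X (prodObj Y Z)) (sndHom X (prodObj Y Z) ≫ sndHom Y Z)) eT eXZ h3 hgT h3' hgXZ
            (integralHodgeClassesCup (prodObj X (prodObj Y Z)).toIsog.Φ hab
              (integralHodgeClassesPullbackHom (liftHom (fstHom X (prodObj Y Z)) (sndHom X (prodObj Y Z) ≫ fstHom Y Z)) a α)
              (integralHodgeClassesPullbackHom (sndHom X (prodObj Y Z)) b β)))
          (integralHodgeClassesPullbackHom (fstHom X Z) p x)) =
      integralHodgeClassesPushforward q₄ d (sndHom X (prodObj Y Z) ≫ sndHom Y Z) eT eZ h5 hgT h4' hgZ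
        (integralHodgeClassesCup (prodObj X (prodObj Y Z)).toIsog.Φ hq₄
          (integralHodgeClassesCup (prodObj X (prodObj Y Z)).toIsog.Φ hab
            (integralHodgeClassesPullbackHom (liftHom (fstHom X (prodObj Y Z)) (sndHom X (prodObj Y Z) ≫ fstHom Y Z)) a α)
            (integralHodgeClassesPullbackHom (sndHom X (prodObj Y Z)) b β))
          (integralHodgeClassesPullbackHom (fstHom X (prodObj Y Z)) p x)) := by
  rw [← integralHodgeClassesPushforward_cup_pullbackHom (liftHom (fstHom X (prodObj Y Z)) (sndHom X (prodObj Y Z) ≫ sndHom Y Z)) eT eXZ hgT hgXZ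
      hq₄ hq₃ h3 h3' h5 h4, ← integralHodgeClassesPullbackHom_comp, liftHom_fstHom, ← integralHodgeClassesPushforward_comp, liftHom_sndHom]

-- Two long rewrite chains through `(X × Y) × Z ≅ X × (Y × Z)`: about twice the default elaboration budget.
set_option maxHeartbeats 400000 in
include hgg₂ hggT hab in
/-- **`β_*(α_*(x)) = π₃*(p₁₂^*α · p₂₃^*β · π₁^* x)`** on `X × Y × Z`: the second half of Fulton's computation — flat base change
`p_Y^{YZ*} p_{Y*}^{XY} = (p_Y^{XY} × 1_Z)_* p₁₂'^*` on `(X × Y) × Z` (§1), projection formula for `p_Y^{XY} × 1_Z`, `(p_Y × 1_Z) ≫ p_Z = π₃'`, and the associator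
`(X × Y) × Z ≅ X × (Y × Z)` carrying `p₁₂', p₂₃', π₁', π₃'` to `p₁₂, p₂₃, π₁, π₃` (`(assoc ≫ π₃)_* assoc^* = π₃*`).
[cite: Fulton1998, §16.1 Prop. 16.1.2 (a) (p0295 L20–L27, p0296 L1–L7) and §1.7 Prop. 1.7 (p0030)] [cite: Lange2023AbelianVarietiesComplex, §6.2.2 (p0303 L19–L29)] -/
theorem integralHodgeClassesCorr_act_act_eq (α : integralHodgeClasses (prodObj X Y).toIsog.Φ a) (β : integralHodgeClasses (prodObj Y Z).toIsog.Φ b)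
    (x : integralHodgeClasses X.toIsog.Φ p) :
    integralHodgeClassesPushforward q₂ d (sndHom Y Z) eYZ eZ h2 hgYZ h2' hgZ
        (integralHodgeClassesCup (prodObj Y Z).toIsog.Φ hq₂ β
          (integralHodgeClassesPullbackHom (fstHom Y Z) c
            (integralHodgeClassesPushforward q₁ c (sndHom X Y) eXY eY h1 hgXY h1' hgY
              (integralHodgeClassesCup (prodObj X Y).toIsog.Φ hq₁ α (integralHodgeClassesPullbackHom (fstHom X Y) p x))))) =
      integralHodgeClassesPushforward q₄ d (sndHom X (prodObj Y Z) ≫ sndHom Y Z) eT eZ h5' hgT h2' hgZ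
        (integralHodgeClassesCup (prodObj X (prodObj Y Z)).toIsog.Φ hq₄
          (integralHodgeClassesCup (prodObj X (prodObj Y Z)).toIsog.Φ hab
            (integralHodgeClassesPullbackHom (liftHom (fstHom X (prodObj Y Z)) (sndHom X (prodObj Y Z) ≫ fstHom Y Z)) a α)
            (integralHodgeClassesPullbackHom (sndHom X (prodObj Y Z)) b β))
          (integralHodgeClassesPullbackHom (fstHom X (prodObj Y Z)) p x)) := by
  haveI : IsIso (prodAssocHom X Y Z) := (prodAssocIso X Y Z).isIso_hom
  have hT : l₂ + 2 * (q₁ + b) = 2 * gT := by omega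
  -- base change, projection formula for `p₂₃' = p_Y^{XY} × 1_Z`, `p₂₃' ≫ p_Z = π₃' = assoc ≫ π₃`
  rw [← integralHodgeClassesPushforward_prodMap_id_pullbackHom_fstHom' (sndHom X Y) Z eXY eY h1 hgXY h1' hgY eZ (eT.trans (Equiv.sumAssoc _ _ _).symm) eYZ
      (by omega : 2 * gXY + 2 * gZ = 2 * gT) (by omega : 2 * gY + 2 * gZ = 2 * gYZ)
      (show (l₁ + 2 * gZ) + 2 * q₁ = 2 * gT by omega) hgT (show (l₁ + 2 * gZ) + 2 * c = 2 * gYZ by omega) hgYZ,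
    integralHodgeClassesCup_comm _ (show c + b = q₂ by omega) hq₂,
    ← integralHodgeClassesPushforward_cup_pullbackHom (prodMap (sndHom X Y) (𝟙 Z)) (eT.trans (Equiv.sumAssoc _ _ _).symm) eYZ hgT hgYZ
      (show q₁ + b = q₄ by omega) (show c + b = q₂ by omega) (show (l₁ + 2 * gZ) + 2 * q₁ = 2 * gT by omega) (show (l₁ + 2 * gZ) + 2 * c = 2 * gYZ by omega)
      h5' h2,
    ← integralHodgeClassesPushforward_comp, prodMap_sndHom, Category.comp_id, ← prodAssocHom_sndHom_sndHom]
  -- `W = assoc^*(u · π₁^* x)` on `(X × Y) × Z`, then `(assoc ≫ π₃)_* assoc^* = π₃*`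
  rw [integralHodgeClassesPullbackHom_cup, ← integralHodgeClassesPullbackHom_comp, ← prodAssocHom_fstHom, ← prodAssocHom_comp_sndHom,
    ← prodAssocHom_comp_liftHom_fst_sndfst, integralHodgeClassesPullbackHom_comp, integralHodgeClassesPullbackHom_comp, integralHodgeClassesPullbackHom_comp,
    ← integralHodgeClassesPullbackHom_cup, ← integralHodgeClassesPullbackHom_cup,
    integralHodgeClassesCup_assoc _ hq₁ (show q₁ + b = q₄ by omega) (rfl : p + b = p + b) (show a + (p + b) = q₄ by omega),
    integralHodgeClassesCup_comm _ (show b + p = p + b by omega) (rfl : p + b = p + b),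
    ← integralHodgeClassesCup_assoc _ hab hq₄ (show b + p = p + b by omega) (show a + (p + b) = q₄ by omega)]
  exact integralHodgeClassesPushforward_comp_pullbackHom_of_isIso (prodAssocHom X Y Z) (sndHom X (prodObj Y Z) ≫ sndHom Y Z)
    (eT.trans (Equiv.sumAssoc _ _ _).symm) eT eZ h5' hgT h2' hgZ _

include hgg₂ hggT h3 h3' in
/-- **FULTON'S PROP. 16.1.2 (a) ON INTEGRAL HODGE CLASSES: `(β ∘ α)_* = β_* ∘ α_*`.** For correspondences `α ∈ Hdgᵃ(X × Y, ℤ)`, `β ∈ Hdgᵇ(Y × Z, ℤ)`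
between complex tori and `x ∈ Hdgᵖ(X, ℤ)`, with `α_*(x) = p_{Y*}(α · p_X^* x)` (Fulton Def. 16.1.2 / Birkenhake–Lange §6.2.2 "`Z(α) := p_{2*}(Z · p₁^*α)`") and
`β ∘ α = p₁₃*(p₁₂^*α · p₂₃^*β)` on `X × Y × Z` (Fulton Def. 16.1.1, g27-#5's convention `X × (Y × Z)`, `p₁₂ = (p₁, p₁p₂)`, `p₂₃ = p₂`, `p₁₃ = (p₁, p₂p₂)`):
`(β ∘ α)_*(x) = β_*(α_*(x))`. Proof as printed (Fulton p0296 L1–L6 for Prop. 16.1.1 (a), "the other proofs are similar"): both sides equal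
`π₃*(p₁₂^*α · p₂₃^*β · π₁^* x)` (the two lemmas above: projection formula g27-#2, functoriality of `_*` and `^*`, flat base change from the product
formula g27-#7, the associator). All push-forwards are those of g27-#2 in the displayed lattice frames (independent of them, g27-#3).
[cite: Fulton1998, §16.1 Def. 16.1.1, Def. 16.1.2, Prop. 16.1.2 (a) (p0294 L21–L28, p0295 L9–L27, p0296 L1–L7)]
[cite: Lange2023AbelianVarietiesComplex, §6.2.2 (p0303 L19–L29)] -/
theorem integralHodgeClassesCorrComp_act (α : integralHodgeClasses (prodObj X Y).toIsog.Φ a) (β : integralHodgeClasses (prodObj Y Z).toIsog.Φ b)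
    (x : integralHodgeClasses X.toIsog.Φ p) :
    integralHodgeClassesPushforward q₃ d (sndHom X Z) eXZ eZ h4 hgXZ h4' hgZ
        (integralHodgeClassesCup (prodObj X Z).toIsog.Φ hq₃
          (integralHodgeClassesPushforward ab m (liftHom (fstHom X (prodObj Y Z)) (sndHom X (prodObj Y Z) ≫ sndHom Y Z)) eT eXZ h3 hgT h3' hgXZ
            (integralHodgeClassesCup (prodObj X (prodObj Y Z)).toIsog.Φ hab
              (integralHodgeClassesPullbackHom (liftHom (fstHom X (prodObj Y Z)) (sndHom X (prodObj Y Z) ≫ fstHom Y Z)) a α)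
              (integralHodgeClassesPullbackHom (sndHom X (prodObj Y Z)) b β)))
          (integralHodgeClassesPullbackHom (fstHom X Z) p x)) =
      integralHodgeClassesPushforward q₂ d (sndHom Y Z) eYZ eZ h2 hgYZ h2' hgZ
        (integralHodgeClassesCup (prodObj Y Z).toIsog.Φ hq₂ β
          (integralHodgeClassesPullbackHom (fstHom Y Z) c
            (integralHodgeClassesPushforward q₁ c (sndHom X Y) eXY eY h1 hgXY h1' hgY
              (integralHodgeClassesCup (prodObj X Y).toIsog.Φ hq₁ α (integralHodgeClassesPullbackHom (fstHom X Y) p x))))) := by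
  obtain rfl : l₄ = l₂ := by omega
  exact (integralHodgeClassesCorrComp_act_eq eZ eXZ eT hgZ hgXZ hgT hab hq₃ (show ab + p = q₁ + b by omega) h3 h3' h4 h4' (by omega) α β x).trans
    (integralHodgeClassesCorr_act_act_eq hgg₂ hggT eY eZ eXY eYZ eT hgY hgZ hgXY hgYZ hgT hq₁ hq₂ hab (show ab + p = q₁ + b by omega) h1 h1' h2 h2'
      (by omega) α β x).symm

end Functoriality

end ComplexTorusCat

end Literature.AlgebraicGeometry.HodgeTheory
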